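import Literature.NumberTheory.Transcendental.ZudilinBlocks
import Literature.NumberTheory.Transcendental.ZudilinNormConst
import HarnessLib

/-!
# The amplitude of Zudilin's `Rₙ(nκ)`: `Rₙ(nκ) = n⁻⁷ exp(n ψ(κ) + A(κ) + o(1))`

Topic `Literature/NumberTheory/Transcendental`; continues `ZudilinBlocks.lean`,
`ZudilinNormConst.lean`, `ZudilinPhase.lean`. Everything here is PROVED; no definitions, no named
facts.

With `ψ = Zudilin2004.psiR`, `A = Zudilin2004.amp` and Zudilin's rational function
`Rₙ = Zudilin2004.R n` ([Zudilin2004, §8 (8.7), Thm. 3], Fischler's variable `k = nκ`):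

* `Zudilin2004.R_scaled_eq` — `Rₙ(nκ)` as `normConst · n(37+2κ) · (n^{27n} e^{S₁})³ (n^{27n} e^{S₂})³ /
  ∏_v (n^{(13+2v)n+1} e^{S_v})`, the `S`'s being the block sums of principal logarithms;
* `Zudilin2004.R_scaled_mul_eq_exp` — the exact identity
  `Rₙ(nκ) · n⁷ · exp(−(nψ(κ) + A(κ))) = exp(Eₙ(κ))`, where `Eₙ(κ)` is the sum of the Stirling error
  of the normalising constant and the Euler–Maclaurin errors of the blocks (all the terms
  `n log n`, `log n`, `n`, `1` cancel block by block);
* `Zudilin2004.tendstoUniformlyOn_R_scaled` — `‖Eₙ(κ)‖ ≤ |εₙ| + C(u₁)/n` on `im κ ≥ u₁ > 0`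
  (proved inside), hence `Rₙ(nκ) n⁷ e^{−(nψ(κ)+A(κ))} → 1` uniformly there
  ([Zudilin2004, Lemma 20]: the integrand is `e^{n f(τ)} g(τ)(1 + O(1/n))`, cf. [Zudilin2002, §4 Lemma 3]).

## References

* [Zudilin2004] W. Zudilin, J. Théor. Nombres Bordeaux 16 (2004), §8 ((8.6)–(8.7), Lemma 20).
* [Zudilin2002] W. Zudilin, Izv. Math. 66 (2002), §4, Lemma 3.
-/

noncomputable section

open Finset Complex Filter
open scoped Topology Real

namespace Literature.NumberTheory.Transcendental

namespace Zudilin2004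

/-! ### Products of linear factors as exponentials of sums of logarithms -/

/-- `∏ (c · fᵢ) = c^{#s} · exp(Σ log fᵢ)` when no `fᵢ` vanishes. [folklore] -/
theorem prod_const_mul_eq_pow_mul_exp {s : Finset ℕ} {f : ℕ → ℂ} (hf : ∀ i ∈ s, f i ≠ 0) (c : ℂ) :
    ∏ i ∈ s, c * f i = c ^ s.card * exp (∑ i ∈ s, log (f i)) := by
  rw [prod_mul_distrib, prod_const, Complex.exp_sum]
  congr 1
  exact prod_congr rfl fun i hi ↦ (Complex.exp_log (hf i hi)).symm

/-- The cardinality of the denominator block `[(12−v)n, (25+v)n]` is `(13+2v)n + 1` (`v ≤ 12`).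
[folklore] -/
theorem card_block (n : ℕ) {v : ℕ} (hv : v ≤ 12) :
    (Icc ((12 - v) * n) ((25 + v) * n)).card = (13 + 2 * v) * n + 1 := by
  rw [Nat.card_Icc]
  have hsplit : (25 + v) * n = (13 + 2 * v) * n + (12 - v) * n := by
    rw [← Nat.add_mul]; congr 1; omega
  rw [hsplit]
  generalize (13 + 2 * v) * n = a
  generalize (12 - v) * n = b
  omega

/-- **`Rₙ(nκ)` in exponential form** (`n ≥ 1`, `im κ ≠ 0`). [cite: Zudilin2004, §8 (8.7)] -/
theorem R_scaled_eq {n : ℕ} (hn : 1 ≤ n) {κ : ℂ} (hκ : κ.im ≠ 0) :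
    R n ((n : ℂ) * κ) = (normConst n : ℂ) * ((n : ℂ) * (37 + 2 * κ)) *
      ((n : ℂ) ^ (27 * n) * exp (∑ i ∈ Icc 1 (27 * n), log (κ - (i : ℂ) / n))) ^ 3 *
      ((n : ℂ) ^ (27 * n) * exp (∑ i ∈ Icc (37 * n + 1) (64 * n), log (κ + (i : ℂ) / n))) ^ 3 /
      ∏ v ∈ Icc 1 10, ((n : ℂ) ^ ((13 + 2 * v) * n + 1) *
        exp (∑ i ∈ Icc ((12 - v) * n) ((25 + v) * n), log (κ + (i : ℂ) / n))) := by
  have hn0 : (n : ℂ) ≠ 0 := by exact_mod_cast (show n ≠ 0 by omega)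
  have hne_sub : ∀ i : ℕ, κ - (i : ℂ) / n ≠ 0 := fun i h0 ↦ by
    have := congrArg Complex.im h0
    simp at this
    exact hκ this
  have hne_add : ∀ i : ℕ, κ + (i : ℂ) / n ≠ 0 := fun i h0 ↦ by
    have := congrArg Complex.im h0
    simp at this
    exact hκ this
  have h1 : ∏ i ∈ Icc 1 (27 * n), ((n : ℂ) * κ - i) =
      (n : ℂ) ^ (27 * n) * exp (∑ i ∈ Icc 1 (27 * n), log (κ - (i : ℂ) / n)) := by
    calc ∏ i ∈ Icc 1 (27 * n), ((n : ℂ) * κ - i)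
        = ∏ i ∈ Icc 1 (27 * n), ((n : ℂ) * (κ - (i : ℂ) / n)) :=
          prod_congr rfl fun i _ ↦ by field_simp
      _ = (n : ℂ) ^ (Icc 1 (27 * n)).card * exp (∑ i ∈ Icc 1 (27 * n), log (κ - (i : ℂ) / n)) :=
          prod_const_mul_eq_pow_mul_exp (fun i _ ↦ hne_sub i) _
      _ = _ := by rw [Nat.card_Icc, show 27 * n + 1 - 1 = 27 * n from rfl]
  have h2 : ∏ i ∈ Icc (37 * n + 1) (64 * n), ((n : ℂ) * κ + i) =
      (n : ℂ) ^ (27 * n) * exp (∑ i ∈ Icc (37 * n + 1) (64 * n), log (κ + (i : ℂ) / n)) := by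
    calc ∏ i ∈ Icc (37 * n + 1) (64 * n), ((n : ℂ) * κ + i)
        = ∏ i ∈ Icc (37 * n + 1) (64 * n), ((n : ℂ) * (κ + (i : ℂ) / n)) :=
          prod_congr rfl fun i _ ↦ by field_simp
      _ = (n : ℂ) ^ (Icc (37 * n + 1) (64 * n)).card *
            exp (∑ i ∈ Icc (37 * n + 1) (64 * n), log (κ + (i : ℂ) / n)) :=
          prod_const_mul_eq_pow_mul_exp (fun i _ ↦ hne_add i) _
      _ = _ := by rw [Nat.card_Icc, show 64 * n + 1 - (37 * n + 1) = 27 * n by omega]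
  have h3 : ∀ v ∈ Icc 1 10, ∏ i ∈ Icc ((12 - v) * n) ((25 + v) * n), ((n : ℂ) * κ + i) =
      (n : ℂ) ^ ((13 + 2 * v) * n + 1) *
        exp (∑ i ∈ Icc ((12 - v) * n) ((25 + v) * n), log (κ + (i : ℂ) / n)) := by
    intro v hv
    calc ∏ i ∈ Icc ((12 - v) * n) ((25 + v) * n), ((n : ℂ) * κ + i)
        = ∏ i ∈ Icc ((12 - v) * n) ((25 + v) * n), ((n : ℂ) * (κ + (i : ℂ) / n)) :=
          prod_congr rfl fun i _ ↦ by field_simp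
      _ = (n : ℂ) ^ (Icc ((12 - v) * n) ((25 + v) * n)).card *
            exp (∑ i ∈ Icc ((12 - v) * n) ((25 + v) * n), log (κ + (i : ℂ) / n)) :=
          prod_const_mul_eq_pow_mul_exp (fun i _ ↦ hne_add i) _
      _ = _ := by rw [card_block n (by have := (mem_Icc.1 hv).2; omega)]
  unfold R
  rw [h1, h2, prod_congr rfl h3]
  ring


/-! ### The exact identity `Rₙ(nκ) n⁷ e^{−(nψ+A)} = e^{Eₙ(κ)}` -/

/-- **`Rₙ(nκ) · n⁷ · exp(−(nψ(κ) + A(κ))) = exp(Eₙ(κ))`** with the error term `Eₙ(κ)` displayed on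
the right: the Stirling error of `normConst` (cf. `tendsto_log_normConst_sub`) plus `3, 3, −1`
times the Euler–Maclaurin errors of the blocks (cf. `ZudilinBlocks.lean`). All powers of `n` and
`log n` cancel. [cite: Zudilin2004, §8 Lemma 20] -/
theorem R_scaled_mul_eq_exp {n : ℕ} (hn : 1 ≤ n) {κ : ℂ} (hκ : κ.im ≠ 0) :
    R n ((n : ℂ) * κ) * (n : ℂ) ^ 7 * exp (-((n : ℂ) * psiR κ + amp κ)) =
      exp (((Real.log (normConst n : ℝ) -
          ((∑ u ∈ Icc 1 10, (((13 + 2 * u : ℕ) : ℝ) * n * Real.log n +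
              n * (((13 + 2 * u : ℕ) : ℝ) * Real.log ((13 + 2 * u : ℕ) : ℝ) - ((13 + 2 * u : ℕ) : ℝ)) +
              1 / 2 * Real.log n + 1 / 2 * Real.log (2 * π * ((13 + 2 * u : ℕ) : ℝ)))) -
            6 * (((27 : ℕ) : ℝ) * n * Real.log n +
              n * (((27 : ℕ) : ℝ) * Real.log ((27 : ℕ) : ℝ) - ((27 : ℕ) : ℝ)) +
              1 / 2 * Real.log n + 1 / 2 * Real.log (2 * π * ((27 : ℕ) : ℝ)))) : ℝ) : ℂ) +
        3 * ((∑ i ∈ Icc 1 (27 * n), log (κ - (i : ℂ) / n)) -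
            ((n : ℂ) * blockInt κ (-27) 0 + 1 / 2 * (log (κ - 27) - log κ))) +
        3 * ((∑ i ∈ Icc (37 * n + 1) (64 * n), log (κ + (i : ℂ) / n)) -
            ((n : ℂ) * blockInt κ 37 64 + 1 / 2 * (log (κ + 64) - log (κ + 37)))) -
        ∑ v ∈ Icc 1 10, ((∑ i ∈ Icc ((12 - v) * n) ((25 + v) * n), log (κ + (i : ℂ) / n)) -
            ((n : ℂ) * blockInt κ (12 - (v : ℝ)) (25 + (v : ℝ)) +
              1 / 2 * (log (κ + 12 - (v : ℂ)) + log (κ + 25 + (v : ℂ)))))) := by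
  have hn' : (0 : ℝ) < n := by exact_mod_cast hn
  rw [R_scaled_eq hn hκ]
  -- every atom as an exponential
  set L : ℂ := ((Real.log n : ℝ) : ℂ) with hL
  have hnL : (n : ℂ) = exp L := by
    rw [hL, ← Complex.ofReal_exp, Real.exp_log hn', Complex.ofReal_natCast]
  have hc : (normConst n : ℂ) = exp ((Real.log (normConst n : ℝ) : ℝ) : ℂ) := by
    rw [← Complex.ofReal_exp, Real.exp_log (normConst_pos n), Complex.ofReal_ratCast]
  have hw0 : (37 + 2 * κ : ℂ) ≠ 0 := fun h0 ↦ by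
    have := congrArg Complex.im h0
    simp at this
    exact hκ this
  have hw : (37 + 2 * κ : ℂ) = exp (log (37 + 2 * κ)) := (Complex.exp_log hw0).symm
  have hpow : ∀ m : ℕ, (n : ℂ) ^ m = exp ((m : ℂ) * L) := fun m ↦ by
    rw [hnL, ← Complex.exp_nat_mul]
  rw [show ((n : ℂ) * (37 + 2 * κ)) = exp L * exp (log (37 + 2 * κ)) by rw [← hnL, ← hw],
    hc, hpow (27 * n), hpow 7]
  rw [prod_congr rfl (fun v _ ↦ by rw [hpow ((13 + 2 * v) * n + 1)])]
  simp only [← Complex.exp_add, ← Complex.exp_nat_mul, ← Complex.exp_sum, ← Complex.exp_sub]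
  congr 1
  have e54 : Real.log (54 * π) = Real.log (2 * π * ((27 : ℕ) : ℝ)) := by norm_num; ring_nf
  unfold psiR amp
  rw [e54, hL]
  push_cast
  simp only [Finset.sum_Icc_succ_top (show 1 ≤ 10 by norm_num), Finset.sum_Icc_succ_top (show 1 ≤ 9 by norm_num),
    Finset.sum_Icc_succ_top (show 1 ≤ 8 by norm_num), Finset.sum_Icc_succ_top (show 1 ≤ 7 by norm_num),
    Finset.sum_Icc_succ_top (show 1 ≤ 6 by norm_num), Finset.sum_Icc_succ_top (show 1 ≤ 5 by norm_num),
    Finset.sum_Icc_succ_top (show 1 ≤ 4 by norm_num), Finset.sum_Icc_succ_top (show 1 ≤ 3 by norm_num),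
    Finset.sum_Icc_succ_top (show 1 ≤ 2 by norm_num), Finset.Icc_self, Finset.sum_singleton]
  push_cast
  ring


/-! ### Uniform smallness of the error term -/

/-- **`Rₙ(nκ) n⁷ e^{−(nψ(κ)+A(κ))} → 1` uniformly on `im κ ≥ u₁ > 0`.** Quantitatively: with
`εₙ = log normConst n − (Σ_u St_{13+2u}(n) − 6 St₂₇(n)) → 0` (Stirling) and the block errors
`≤ C(u₁)/n`, the exponent `Eₙ(κ)` of `R_scaled_mul_eq_exp` has
`‖Eₙ(κ)‖ ≤ |εₙ| + (6(3/u₁²+2/u₁) + 30/u₁²)/n`. [cite: Zudilin2004, §8 Lemma 20] -/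
theorem tendstoUniformlyOn_R_scaled {u₁ : ℝ} (hu : 0 < u₁) :
    TendstoUniformlyOn (fun (n : ℕ) (κ : ℂ) ↦ R n ((n : ℂ) * κ) * (n : ℂ) ^ 7 *
      exp (-((n : ℂ) * psiR κ + amp κ))) (fun _ ↦ (1 : ℂ)) atTop {κ : ℂ | u₁ ≤ κ.im} := by
  -- the Stirling error of the normalising constant
  set ε : ℕ → ℝ := fun n ↦ Real.log (normConst n : ℝ) -
      ((∑ u ∈ Icc 1 10, (((13 + 2 * u : ℕ) : ℝ) * n * Real.log n +
          n * (((13 + 2 * u : ℕ) : ℝ) * Real.log ((13 + 2 * u : ℕ) : ℝ) - ((13 + 2 * u : ℕ) : ℝ)) +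
          1 / 2 * Real.log n + 1 / 2 * Real.log (2 * π * ((13 + 2 * u : ℕ) : ℝ)))) -
        6 * (((27 : ℕ) : ℝ) * n * Real.log n +
          n * (((27 : ℕ) : ℝ) * Real.log ((27 : ℕ) : ℝ) - ((27 : ℕ) : ℝ)) +
          1 / 2 * Real.log n + 1 / 2 * Real.log (2 * π * ((27 : ℕ) : ℝ)))) with hε
  have hε0 : Tendsto ε atTop (𝓝 0) := tendsto_log_normConst_sub
  set C : ℝ := 6 * (3 / u₁ ^ 2 + 2 / u₁) + 30 / u₁ ^ 2 with hC
  have hC0 : 0 ≤ C := by positivity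
  have hCn : Tendsto (fun n : ℕ ↦ C / n) atTop (𝓝 0) :=
    tendsto_const_nhds.div_atTop tendsto_natCast_atTop_atTop
  -- the bound on the exponent
  have hbound : ∀ n : ℕ, 1 ≤ n → ∀ κ : ℂ, u₁ ≤ κ.im →
      ∃ E : ℂ, R n ((n : ℂ) * κ) * (n : ℂ) ^ 7 * exp (-((n : ℂ) * psiR κ + amp κ)) = exp E ∧
        ‖E‖ ≤ |ε n| + C / n := by
    intro n hn κ hκ
    have hκ0 : κ.im ≠ 0 := by linarith
    have hn' : (0 : ℝ) < n := by exact_mod_cast hn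
    refine ⟨_, R_scaled_mul_eq_exp hn hκ0, ?_⟩
    have hA := norm_blockSum_one_sub_le hu hκ hn
    have hB := norm_blockSum_two_sub_le hu hκ hn
    have hD : ∀ v ∈ Icc 1 10, ‖(∑ i ∈ Icc ((12 - v) * n) ((25 + v) * n), log (κ + (i : ℂ) / n)) -
        ((n : ℂ) * blockInt κ (12 - (v : ℝ)) (25 + (v : ℝ)) +
          1 / 2 * (log (κ + 12 - (v : ℂ)) + log (κ + 25 + (v : ℂ))))‖ ≤ 3 / (n * u₁ ^ 2) :=
      fun v hv ↦ norm_blockSum_den_sub_le hu hκ hn hv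
    have hsum : ‖∑ v ∈ Icc 1 10, ((∑ i ∈ Icc ((12 - v) * n) ((25 + v) * n), log (κ + (i : ℂ) / n)) -
        ((n : ℂ) * blockInt κ (12 - (v : ℝ)) (25 + (v : ℝ)) +
          1 / 2 * (log (κ + 12 - (v : ℂ)) + log (κ + 25 + (v : ℂ)))))‖ ≤ 10 * (3 / (n * u₁ ^ 2)) := by
      refine (norm_sum_le _ _).trans ?_
      have := Finset.sum_le_sum hD
      simp only [sum_const, Nat.card_Icc, show 10 + 1 - 1 = 10 from rfl, nsmul_eq_mul] at this
      exact_mod_cast this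
    have hre : ∀ r : ℝ, ‖((r : ℝ) : ℂ)‖ = |r| := fun r ↦ by simp
    calc _ ≤ ‖((ε n : ℝ) : ℂ)‖ + ‖(3 : ℂ) * ((∑ i ∈ Icc 1 (27 * n), log (κ - (i : ℂ) / n)) -
            ((n : ℂ) * blockInt κ (-27) 0 + 1 / 2 * (log (κ - 27) - log κ)))‖ +
          ‖(3 : ℂ) * ((∑ i ∈ Icc (37 * n + 1) (64 * n), log (κ + (i : ℂ) / n)) -
            ((n : ℂ) * blockInt κ 37 64 + 1 / 2 * (log (κ + 64) - log (κ + 37))))‖ +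
          ‖∑ v ∈ Icc 1 10, ((∑ i ∈ Icc ((12 - v) * n) ((25 + v) * n), log (κ + (i : ℂ) / n)) -
            ((n : ℂ) * blockInt κ (12 - (v : ℝ)) (25 + (v : ℝ)) +
              1 / 2 * (log (κ + 12 - (v : ℂ)) + log (κ + 25 + (v : ℂ)))))‖ := by
          exact (norm_sub_le _ _).trans (add_le_add norm_add₃_le le_rfl)
      _ ≤ |ε n| + 3 * ((3 / u₁ ^ 2 + 2 / u₁) / n) + 3 * ((3 / u₁ ^ 2 + 2 / u₁) / n) +
          10 * (3 / (n * u₁ ^ 2)) := by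
          rw [hre]
          refine add_le_add (add_le_add (add_le_add le_rfl ?_) ?_) hsum
          · rw [norm_mul]; norm_num; exact hA
          · rw [norm_mul]; norm_num; exact hB
      _ = |ε n| + C / n := by rw [hC]; field_simp; ring
  -- conclusion
  rw [Metric.tendstoUniformlyOn_iff]
  intro δ hδ
  have hsmall : ∀ᶠ n : ℕ in atTop, |ε n| + C / n < min 1 (δ / 2) := by
    have h := (hε0.abs.add hCn)
    rw [show |(0 : ℝ)| + 0 = 0 by simp] at h
    exact h.eventually (gt_mem_nhds (by positivity))
  filter_upwards [hsmall, eventually_ge_atTop 1] with n hn hn1 κ hκ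
  obtain ⟨E, hE, hEle⟩ := hbound n hn1 κ hκ
  rw [hE, dist_comm, dist_eq_norm]
  have hE1 : ‖E‖ ≤ 1 := (hEle.trans hn.le).trans (min_le_left _ _)
  calc ‖exp E - 1‖ ≤ 2 * ‖E‖ := Complex.norm_exp_sub_one_le hE1
    _ < δ := by
        have : ‖E‖ < δ / 2 := (hEle.trans_lt hn).trans_le (min_le_right _ _)
        linarith

end Zudilin2004

end Literature.NumberTheory.Transcendental
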